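import Mathlib
import Literature.NumberTheory.Transcendental.ExpOneTranscendenceMeasureProofs
import HarnessLib

/-!
# Route `DiophantineDichotomy`, crux `KhovanskiiApproxTypeEv` (stmt-Schanuel-14972), line `lambert-liouville-kill`:
# stub `stub_expOneDegreeMeasure` — per-degree measure of algebraic approximation of `e`

Crux `Summit.Schanuel.Schanuel.Theses.DiophantineDichotomy.KhovanskiiApproxTypeEv` (item stmt-Schanuel-14972),
certificate line `lambert-liouville-kill` (skeleton `Cruxes/KhovanskiiApproxTypeEv/Lines/lambert_liouville_kill.lean`,
lead `prover-line-stmt-Schanuel-14972-a1-0`), registered stub `stub_expOneDegreeMeasure` (landed `--supports stmt-Schanuel-14972`).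

The stub says: for every degree bound `N ≥ 1` there are `κ, c₀ > 0` with `|e − α| ≥ c₀ H^{−κ}` for
every root `α` of a non-zero `P ∈ ℤ[X]` of degree `≤ N` and naive height `≤ H` (`H ≥ 1`), i.e. a
POLYNOMIAL-in-`H` measure of algebraic approximation of `e` at each fixed degree.  In the certificates
`notLiouville_lambert_of_ev(Anchored)` it is the synchroniser (the hypothesis of `stub_syncDiaz` and
`stub_syncApproximant`): it pins the height of Diaz's approximant of `e` to the Liouville scale.
Proof: factor `P` in the UFD `ℤ[X]`; some irreducible factor `Q` (degree `1 ≤ D ≤ N`) vanishes at `α`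
and `M(Q) ≤ M(P) ≤ L(P) ≤ (N+1) H`; the PROVED tree theorem
`Literature.NumberTheory.Transcendental.NW1996.approx_measure_exp_one` (Nesterenko–Waldschmidt 1996,
Theorem 4 (1), Mahler-measure form) with `ℓ := 1 + log (N+1) + log H` gives
`|e − α| ≥ exp(−63021 D²(D + ℓ)) ≥ exp(−63021 N²(N + ℓ)) = c₀ H^{−κ}` with `κ := 63021 N²`,
`c₀ := exp(−63021 N³ − κ (1 + log (N+1)))`.  Tree inputs used by name: `NW1996.approx_measure_exp_one`,
`NW1996.irreducible_map_rat_of_irreducible`, `NW1996.mahlerMeasure_le_of_mul`,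
`NW1996.one_le_mahlerMeasure_map`, `NW1996.mahlerMeasure_map_le_length`.
-/

noncomputable section

-- `Summit.Schanuel.Schanuel.…` is the mandated summit/sub-problem namespace (single-conjunct summit), hence:
set_option linter.dupNamespace false

namespace Summit.Schanuel.Schanuel.Cruxes.KhovanskiiApproxTypeEv.LambertLiouvilleKill

open Polynomial
open Literature.NumberTheory.Transcendental.NW1996

/-- A root `α ∈ ℂ` of a non-zero `P ∈ ℤ[X]` is a root of some factor `Q` of `P` that is irreducible
over `ℚ`, with `1 ≤ deg Q ≤ deg P` and `M(Q) ≤ M(P)`: factor `P` in the UFD `ℤ[X]` (the unit is `±1`);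
`aeval α` is a ring hom, so some irreducible factor vanishes at `α`, and such a factor is non-constant,
hence (Gauss) irreducible over `ℚ`; Mahler measures of non-zero integer polynomials are `≥ 1` and
multiplicative. [folklore] -/
theorem exists_irreducible_factor_of_aeval_eq_zero {P : ℤ[X]} (hP : P ≠ 0) {α : ℂ}
    (hα : aeval α P = 0) :
    ∃ Q : ℤ[X], Irreducible (Q.map (Int.castRingHom ℚ)) ∧ aeval α Q = 0 ∧
      1 ≤ Q.natDegree ∧ Q.natDegree ≤ P.natDegree ∧
      (Q.map (Int.castRingHom ℂ)).mahlerMeasure ≤ (P.map (Int.castRingHom ℂ)).mahlerMeasure := by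
  classical
  -- adapted from `NW1996.transference` (Literature/NumberTheory/Transcendental/
  -- ExpOneTranscendenceMeasureTransference.lean): the factorisation bookkeeping
  obtain ⟨u, hu⟩ := UniqueFactorizationMonoid.factors_prod hP
  set F := UniqueFactorizationMonoid.factors P with hF
  obtain ⟨r, hr, hru⟩ := Polynomial.isUnit_iff.mp u.isUnit
  have hr1 : ‖(r : ℂ)‖ = 1 := by
    rcases Int.isUnit_iff.mp hr with h | h <;> simp [h]
  have hr0 : r ≠ 0 := hr.ne_zero
  have hPeq : P = F.prod * C r := by rw [hru, hu]
  have hF0 : ∀ q ∈ F, q ≠ 0 := fun q hq =>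
    (UniqueFactorizationMonoid.irreducible_of_factor q hq).ne_zero
  have hFprod0 : F.prod ≠ 0 := by
    rw [ne_eq, Multiset.prod_eq_zero_iff]; exact fun h => hF0 0 h rfl
  have hdegP : P.natDegree = F.prod.natDegree := by
    rw [hPeq, natDegree_mul_C hr0]
  have hMP : (P.map (Int.castRingHom ℂ)).mahlerMeasure =
      (F.prod.map (Int.castRingHom ℂ)).mahlerMeasure := by
    rw [hPeq, Polynomial.map_mul, mahlerMeasure_mul, Polynomial.map_C, mahlerMeasure_const,
      eq_intCast, hr1, mul_one]
  -- some factor vanishes at `α`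
  have hprod0 : aeval α F.prod = 0 := by
    have h1 : aeval α P = aeval α F.prod * (r : ℂ) := by
      rw [hPeq, map_mul, aeval_C, eq_intCast]
    have hrC : (r : ℂ) ≠ 0 := by exact_mod_cast hr0
    rw [h1] at hα
    exact (mul_eq_zero.mp hα).resolve_right hrC
  rw [map_multiset_prod, Multiset.prod_eq_zero_iff, Multiset.mem_map] at hprod0
  obtain ⟨Q, hQF, hQα⟩ := hprod0
  have hQ0 : Q ≠ 0 := hF0 Q hQF
  have hirr : Irreducible Q := UniqueFactorizationMonoid.irreducible_of_factor Q hQF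
  -- `Q` is non-constant since it vanishes at `α`
  have hpos : 0 < Q.natDegree := by
    rcases Nat.eq_zero_or_pos Q.natDegree with h0 | hpos
    · exfalso
      have hc : Q.coeff 0 ≠ 0 := by
        intro hc; apply hQ0; rw [eq_C_of_natDegree_eq_zero h0, hc, C_0]
      apply hc
      rw [eq_C_of_natDegree_eq_zero h0, aeval_C, eq_intCast, Int.cast_eq_zero] at hQα
      exact hQα
    · exact hpos
  -- `Q` divides `F.prod`
  obtain ⟨t, ht⟩ : ∃ t, F = Q ::ₘ t := Multiset.exists_cons_of_mem hQF
  have hprod : F.prod = Q * t.prod := by rw [ht, Multiset.prod_cons]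
  have ht0 : t.prod ≠ 0 := by
    intro h; apply hFprod0; rw [hprod, h, mul_zero]
  refine ⟨Q, irreducible_map_rat_of_irreducible hirr hpos, hQα, hpos, ?_, ?_⟩
  · rw [hdegP, hprod, natDegree_mul hQ0 ht0]; exact Nat.le_add_right _ _
  · rw [hMP, hprod]; exact mahlerMeasure_le_of_mul ht0

/-- The length `L(P) = ∑_{k ≤ deg P} |c_k|` of an integer polynomial whose coefficients are bounded by
`H` in absolute value is at most `(deg P + 1) · H`. [folklore] -/
theorem length_le_of_coeff_le (P : ℤ[X]) (H : ℕ) (hH : ∀ j, |P.coeff j| ≤ (H : ℤ)) :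
    (∑ k ∈ Finset.range (P.natDegree + 1), |(P.coeff k : ℝ)|) ≤ ((P.natDegree : ℝ) + 1) * H := by
  calc (∑ k ∈ Finset.range (P.natDegree + 1), |(P.coeff k : ℝ)|)
      ≤ ∑ _k ∈ Finset.range (P.natDegree + 1), (H : ℝ) := by
        refine Finset.sum_le_sum fun k _ => ?_
        have := hH k
        rw [← Int.cast_abs]
        exact_mod_cast this
    _ = ((P.natDegree : ℝ) + 1) * H := by
        rw [Finset.sum_const, Finset.card_range, nsmul_eq_mul]; push_cast; ring

/-- **STUB 2** (per-degree measure of algebraic approximation of `e`: `e` is no `U*`-number).  For every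
degree bound `N ≥ 1` there are `κ, c₀ > 0` with `|e − α| ≥ c₀ H^{−κ}` for every root `α` of a non-zero
`P ∈ ℤ[X]` of degree `≤ N` and naive height `≤ H` (`H ≥ 1`).  Explicitly `κ = 63021 N²` and
`c₀ = exp(−63021 N³ − κ (1 + log (N+1)))`.  Proof: some factor `Q` of `P`, irreducible over `ℚ`, of
degree `1 ≤ D ≤ N`, vanishes at `α` (`exists_irreducible_factor_of_aeval_eq_zero`), and
`log M(Q) ≤ log M(P) ≤ log L(P) ≤ log ((N+1) H) ≤ ℓ := 1 + log (N+1) + log H` (`ℓ ≥ 1`); the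
Nesterenko–Waldschmidt approximation measure `NW1996.approx_measure_exp_one` (PROVED in tree) gives
`|e − α| ≥ exp(−63021 D²(D + ℓ)) ≥ exp(−63021 N²(N + ℓ)) = c₀ H^{−κ}`.
[cite: NesterenkoWaldschmidt1996, Theorem 4 (1) and §6] -/
theorem stub_expOneDegreeMeasure :
    ∀ N : ℕ, 1 ≤ N → ∃ κ c₀ : ℝ, 0 < κ ∧ 0 < c₀ ∧ ∀ (α : ℂ) (P : ℤ[X]) (H : ℕ), P ≠ 0 →
      Polynomial.aeval α P = 0 → P.natDegree ≤ N → 1 ≤ H → (∀ j, |P.coeff j| ≤ (H : ℤ)) →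
      c₀ * (H : ℝ) ^ (-κ) ≤ ‖Complex.exp 1 - α‖ := by
  intro N hN
  obtain ⟨κ, hκ⟩ : ∃ κ : ℝ, κ = 63021 * (N : ℝ) ^ 2 := ⟨_, rfl⟩
  have hNr : (1 : ℝ) ≤ N := by exact_mod_cast hN
  have hκpos : 0 < κ := by rw [hκ]; positivity
  refine ⟨κ, Real.exp (-(63021 * (N : ℝ) ^ 3 + κ * (1 + Real.log ((N : ℝ) + 1)))), hκpos,
    Real.exp_pos _, ?_⟩
  intro α P H hP hα hdeg hH hcoeff
  obtain ⟨Q, hQirr, hQα, hD1, hDle, hMQ⟩ := exists_irreducible_factor_of_aeval_eq_zero hP hα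
  have hDN : Q.natDegree ≤ N := hDle.trans hdeg
  have hDNr : (Q.natDegree : ℝ) ≤ N := by exact_mod_cast hDN
  have hHr : (1 : ℝ) ≤ H := by exact_mod_cast hH
  have hHpos : (0 : ℝ) < H := by linarith
  have hlogH : 0 ≤ Real.log H := Real.log_nonneg hHr
  have hlogN : 0 ≤ Real.log ((N : ℝ) + 1) := Real.log_nonneg (by linarith)
  obtain ⟨ℓ, hℓ⟩ : ∃ ℓ : ℝ, ℓ = 1 + Real.log ((N : ℝ) + 1) + Real.log H := ⟨_, rfl⟩
  have hℓ1 : 1 ≤ ℓ := by rw [hℓ]; linarith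
  -- `log M(Q) ≤ log M(P) ≤ log L(P) ≤ log ((N+1) H) ≤ ℓ`
  have hMQℓ : Real.log (Q.map (Int.castRingHom ℂ)).mahlerMeasure ≤ ℓ := by
    have hQ0 : Q ≠ 0 := ne_zero_of_natDegree_gt hD1
    have hMQ1 : 1 ≤ (Q.map (Int.castRingHom ℂ)).mahlerMeasure := one_le_mahlerMeasure_map hQ0
    have hMPle : (P.map (Int.castRingHom ℂ)).mahlerMeasure ≤ ((N : ℝ) + 1) * H := by
      refine (mahlerMeasure_map_le_length P).trans ((length_le_of_coeff_le P H hcoeff).trans ?_)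
      have : (P.natDegree : ℝ) ≤ N := by exact_mod_cast hdeg
      exact mul_le_mul_of_nonneg_right (by linarith) (by positivity)
    calc Real.log (Q.map (Int.castRingHom ℂ)).mahlerMeasure
        ≤ Real.log (((N : ℝ) + 1) * H) := Real.log_le_log (by linarith) (hMQ.trans hMPle)
      _ = Real.log ((N : ℝ) + 1) + Real.log H := Real.log_mul (by positivity) hHpos.ne'
      _ ≤ ℓ := by rw [hℓ]; linarith
  have hmeas := approx_measure_exp_one hQirr hQα hℓ1 hMQℓ
  refine le_trans ?_ hmeas
  -- `c₀ H^{-κ} = exp(-63021 N² (N + ℓ)) ≤ exp(-63021 D² (D + ℓ))`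
  have hHκ : (H : ℝ) ^ (-κ) = Real.exp (-(κ * Real.log H)) := by
    rw [Real.rpow_def_of_pos hHpos]; congr 1; ring
  rw [hHκ, ← Real.exp_add, Real.exp_le_exp]
  have hℓ0 : 0 ≤ ℓ := by linarith
  have hD0 : (0 : ℝ) ≤ Q.natDegree := Nat.cast_nonneg _
  have key : 63021 * (Q.natDegree : ℝ) ^ 2 * (Q.natDegree + ℓ) ≤ 63021 * (N : ℝ) ^ 2 * (N + ℓ) := by
    have h1 : (Q.natDegree : ℝ) ^ 2 ≤ (N : ℝ) ^ 2 := pow_le_pow_left₀ hD0 hDNr 2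
    have h2 : (Q.natDegree : ℝ) + ℓ ≤ N + ℓ := by linarith
    have h3 := mul_le_mul h1 h2 (by positivity) (by positivity)
    nlinarith [h3]
  have hsplit : 63021 * (N : ℝ) ^ 2 * (N + ℓ) =
      63021 * (N : ℝ) ^ 3 + κ * (1 + Real.log ((N : ℝ) + 1)) + κ * Real.log H := by
    rw [hκ, hℓ]; ring
  linarith

end Summit.Schanuel.Schanuel.Cruxes.KhovanskiiApproxTypeEv.LambertLiouvilleKill

end
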